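import Literature.NumberTheory.DiophantineGeometry.MordellThueRamanujanNagellHeightBounds
import HarnessLib

/-!
# von Känel–Matschke, Definition 7.1: the reduction `(x, y) ↦ (u²x, u³y)` of a solution of a Mordell
# equation over `𝒪 = ℤ[1/N_S]` to a primitive integral solution (proofs)

Topic `Literature/NumberTheory/DiophantineGeometry` (family `abc`). A proofs-only companion (theorems only; NO
definition, NO new named fact; D-0014, D-0026) of `MordellThueRamanujanNagellHeightBounds.lean`, where
Definition 7.1 of R. von Känel, B. Matschke, arXiv:1605.06079 = Mem. AMS 286 (2023) [`VonkanelMatschke2023`]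
is typed (`uOne = u₁`, `uTwo = u₂`, `uRatio = u = u₁/u₂`, `IsAlmostPrimitive`). Printed (§7, Def. 7.1 and the
first paragraph of the proof of Thm. 7.2, §10.3): *"We define `u = u₁/u₂` with `u₁ ∈ ℤ_{≥1}` minimal such that
`u₁x, u₁y ∈ ℤ` and with `u₂ ∈ ℤ` maximal such that `u₂⁶` divides `gcd((u₁²x)³, (u₁³y)²)`. Then
`(u²x, u³y) ∈ ℤ × ℤ` is primitive"*; *"define `x' = u²x` and `y' = u³y`. Then `(x', y') ∈ ℤ × ℤ` is a primitive
solution of the Mordell equation `y'² = x'³ + a'` for `a' = u⁶a ∈ ℤ` … any rational prime `p` with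
`ord_p(a') > ord_p(a)` satisfies `p ∣ u₁` and thus `p ∈ S` … therefore `a'_S` divides `a_S`. Further it holds
that `h(a) ≤ 6h(u) + log|a'|`"*, and (second part) *"`h(x) ≤ 2μ(a_S) + h(x')` and
`(2/3)h(y) ≤ 2μ(a_S) + (2/3)h(y')`"*.

## What is proved here

`exists_primitive_reduction` — for a finite `S ⊆ ℕ`, `x, y ∈ 𝒪`, `a ∈ ℚ^×` with `y² = x³ + a`:
there are integers `x', y', a'` with `a' ≠ 0`, `(x', y')` primitive, `y'² = x'³ + a'`, `a'_S ∣ a_S`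
(`mordellLevel S a' ∣ mordellLevel S a`), `h(a) ≤ 6h(u) + log|a'|`, `h(x) ≤ 2h(u) + h(x')`,
`h(y) ≤ 3h(u) + h(y')`, where `u = uRatio x y`. (The typed `uOne` is the least common denominator of `x, y`,
a multiple-free choice of the printed "minimal `u₁`"; all printed consequences hold for it.) Intermediate
lemmas: `uOne_pos`, the integrality of `u₁²x, u₁³y`, `one_le_uTwo`, the divisibilities `u₂² ∣ u₁²x`,
`u₂³ ∣ u₁³y`, primitivity of the quotient pair.

Used by the kernel proof of Thm. 7.2 (i) from the §10 roots (`MordellAlmostPrimitiveHeightBoundsProofs.lean`).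
No `abc` claim; axioms standard.
-/

noncomputable section

open Height

namespace Literature.NumberTheory.DiophantineGeometry

namespace VonKanelMatschke

/-! ### `u₁`: a common denominator -/

/-- `u₁ ≥ 1`. [cite: VonkanelMatschke2023, Def. 7.1 (def:ap)] -/
theorem uOne_pos (x y : ℚ) : 0 < uOne x y :=
  Nat.lcm_pos x.den_pos y.den_pos

/-- `u₁² x ∈ ℤ`: explicitly `u₁²x = x.num · x.den · k²` where `u₁ = x.den · k`.
[cite: VonkanelMatschke2023, Def. 7.1 (def:ap)] -/
theorem exists_uOne_sq_mul_eq (x y : ℚ) : ∃ X : ℤ, ((uOne x y : ℕ) : ℚ) ^ 2 * x = X := by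
  obtain ⟨k, hk⟩ := Nat.dvd_lcm_left x.den y.den
  refine ⟨x.num * x.den * (k : ℤ) ^ 2, ?_⟩
  rw [uOne, hk]
  calc (((x.den * k : ℕ)) : ℚ) ^ 2 * x = (x.den : ℚ) * (k : ℚ) ^ 2 * (x * x.den) := by push_cast; ring
    _ = (x.den : ℚ) * (k : ℚ) ^ 2 * x.num := by rw [Rat.mul_den_eq_num]
    _ = ((x.num * x.den * (k : ℤ) ^ 2 : ℤ) : ℚ) := by push_cast; ring

/-- `u₁³ y ∈ ℤ`: explicitly `u₁³y = y.num · y.den² · k³` where `u₁ = y.den · k`.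
[cite: VonkanelMatschke2023, Def. 7.1 (def:ap)] -/
theorem exists_uOne_cube_mul_eq (x y : ℚ) : ∃ Y : ℤ, ((uOne x y : ℕ) : ℚ) ^ 3 * y = Y := by
  obtain ⟨k, hk⟩ := Nat.dvd_lcm_right x.den y.den
  refine ⟨y.num * (y.den : ℤ) ^ 2 * (k : ℤ) ^ 3, ?_⟩
  rw [uOne, hk]
  calc (((y.den * k : ℕ)) : ℚ) ^ 3 * y = (y.den : ℚ) ^ 2 * (k : ℚ) ^ 3 * (y * y.den) := by push_cast; ring
    _ = (y.den : ℚ) ^ 2 * (k : ℚ) ^ 3 * y.num := by rw [Rat.mul_den_eq_num]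
    _ = ((y.num * (y.den : ℤ) ^ 2 * (k : ℤ) ^ 3 : ℤ) : ℚ) := by push_cast; ring

/-- The primes of `u₁` lie in `S` when `x, y ∈ 𝒪 = ℤ[1/N_S]` (`u₁ = lcm(den x, den y)`).
[cite: VonkanelMatschke2023, §10.3 (proof of Thm. 7.2: "p ∣ u₁ and thus p ∈ S since x, y ∈ 𝒪")] -/
theorem primeFactors_uOne_subset {S : Finset ℕ} {x y : ℚ} (hx : IsSInteger S x) (hy : IsSInteger S y) :
    (uOne x y).primeFactors ⊆ S := by
  intro p hp
  have hp' := Nat.mem_primeFactors.mp hp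
  have hpP := hp'.1
  have hdvd : p ∣ x.den * y.den := hp'.2.1.trans (Nat.lcm_dvd_mul x.den y.den)
  rcases (Nat.Prime.dvd_mul hpP).mp hdvd with h | h
  · exact hx (Nat.mem_primeFactors.mpr ⟨hpP, h, x.den_nz⟩)
  · exact hy (Nat.mem_primeFactors.mpr ⟨hpP, h, y.den_nz⟩)

/-! ### `u₂`: the largest sixth power in `gcd((u₁²x)³, (u₁³y)²)` -/

/-- The defining property of `u₂ = uTwo x y` in terms of integers `X = u₁²x`, `Y = u₁³y` with
`(X, Y) ≠ (0, 0)`: `u₂ ≥ 1`, `u₂⁶ ∣ gcd(X³, Y²)`, and every `n` with `n⁶ ∣ gcd(X³, Y²)` is `≤ u₂`.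
[cite: VonkanelMatschke2023, Def. 7.1 (def:ap)] -/
theorem uTwo_spec {x y : ℚ} {X Y : ℤ} (hX : ((uOne x y : ℕ) : ℚ) ^ 2 * x = X)
    (hY : ((uOne x y : ℕ) : ℚ) ^ 3 * y = Y) (h0 : ¬ (X = 0 ∧ Y = 0)) :
    1 ≤ uTwo x y ∧ uTwo x y ^ 6 ∣ Int.gcd (X ^ 3) (Y ^ 2) ∧
      ∀ n : ℕ, n ^ 6 ∣ Int.gcd (X ^ 3) (Y ^ 2) → n ≤ uTwo x y := by
  have hnumX : (((uOne x y : ℕ) : ℚ) ^ 2 * x).num = X := by rw [hX]; exact Rat.num_intCast X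
  have hnumY : (((uOne x y : ℕ) : ℚ) ^ 3 * y).num = Y := by rw [hY]; exact Rat.num_intCast Y
  have hg0 : Int.gcd (X ^ 3) (Y ^ 2) ≠ 0 := by
    intro h
    rw [Int.gcd_eq_zero_iff] at h
    exact h0 ⟨pow_eq_zero_iff (by norm_num) |>.mp h.1, pow_eq_zero_iff (by norm_num) |>.mp h.2⟩
  have hdef : uTwo x y = Nat.findGreatest (fun n => n ^ 6 ∣ Int.gcd (X ^ 3) (Y ^ 2))
      (Int.gcd (X ^ 3) (Y ^ 2)) := by
    unfold uTwo; rw [hnumX, hnumY]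
  have hle : ∀ n : ℕ, n ^ 6 ∣ Int.gcd (X ^ 3) (Y ^ 2) → n ≤ Int.gcd (X ^ 3) (Y ^ 2) := by
    intro n hn
    have h1 : n ^ 6 ≤ Int.gcd (X ^ 3) (Y ^ 2) := Nat.le_of_dvd (Nat.pos_of_ne_zero hg0) hn
    rcases Nat.eq_zero_or_pos n with hn0 | hn0
    · omega
    · exact le_trans (Nat.le_self_pow (by norm_num) n) h1
  refine ⟨?_, ?_, fun n hn => ?_⟩
  · rw [hdef]
    exact Nat.le_findGreatest (hle 1 (by simp)) (by simp)
  · rw [hdef]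
    exact Nat.findGreatest_spec (P := fun n => n ^ 6 ∣ Int.gcd (X ^ 3) (Y ^ 2)) (hle 1 (by simp)) (by simp)
  · rw [hdef]
    exact Nat.le_findGreatest (hle n hn) hn

/-! ### The primitive integral pair `(x', y') = (u²x, u³y)` and `a' = u⁶a` -/

/-- **The reduction of Definition 7.1 / §10.3** (PROVED): for `a, x, y ∈ 𝒪 = ℤ[1/N_S]` with `a ≠ 0` and
`y² = x³ + a`, writing `u = u_{x,y}`, there are `x', y', a' ∈ ℤ` (`x' = u²x`, `y' = u³y`, `a' = u⁶a`) with
`a' ≠ 0`, `(x', y')` primitive, `y'² = x'³ + a'`, `a'_S ∣ a_S`, `h(a) ≤ 6h(u) + log|a'|`, `h(x) ≤ 2h(u) + h(x')`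
and `h(y) ≤ 3h(u) + h(y')`. [cite: VonkanelMatschke2023, Def. 7.1 (def:ap) and §10.3 (proof of Thm. 7.2 (i), first paragraph)] -/
theorem exists_primitive_reduction {S : Finset ℕ} {a x y : ℚ} (ha : a ≠ 0)
    (hx : IsSInteger S x) (hy : IsSInteger S y) (hxy : y ^ 2 = x ^ 3 + a) :
    ∃ x' y' a' : ℤ, a' ≠ 0 ∧ IsPrimitivePair x' y' ∧ y' ^ 2 = x' ^ 3 + a' ∧
      mordellLevel S (a' : ℚ) ∣ mordellLevel S a ∧
      logHeight₁ a ≤ 6 * logHeight₁ (uRatio x y) + Real.log |(a' : ℝ)| ∧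
      logHeight₁ x ≤ 2 * logHeight₁ (uRatio x y) + logHeight₁ (x' : ℚ) ∧
      logHeight₁ y ≤ 3 * logHeight₁ (uRatio x y) + logHeight₁ (y' : ℚ) := by
  obtain ⟨X, hX⟩ := exists_uOne_sq_mul_eq x y
  obtain ⟨Y, hY⟩ := exists_uOne_cube_mul_eq x y
  set u₁ : ℕ := uOne x y with hu₁
  have hu₁0 : (u₁ : ℚ) ≠ 0 := by exact_mod_cast (uOne_pos x y).ne'
  -- `(X, Y) ≠ (0, 0)` since `a ≠ 0`
  have hXY : ¬ (X = 0 ∧ Y = 0) := by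
    rintro ⟨hX0, hY0⟩
    have hx0 : x = 0 := by
      have : ((u₁ : ℕ) : ℚ) ^ 2 * x = 0 := by rw [hX, hX0]; simp
      rcases mul_eq_zero.mp this with h | h
      · exact absurd h (pow_ne_zero 2 hu₁0)
      · exact h
    have hy0 : y = 0 := by
      have : ((u₁ : ℕ) : ℚ) ^ 3 * y = 0 := by rw [hY, hY0]; simp
      rcases mul_eq_zero.mp this with h | h
      · exact absurd h (pow_ne_zero 3 hu₁0)
      · exact h
    rw [hx0, hy0] at hxy
    exact ha (by simpa using hxy.symm)
  obtain ⟨hu₂1, hu₂dvd, hu₂max⟩ := uTwo_spec hX hY hXY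
  set u₂ : ℕ := uTwo x y with hu₂
  have hu₂0 : (u₂ : ℤ) ≠ 0 := by exact_mod_cast (show u₂ ≠ 0 by omega)
  -- `u₂² ∣ X`, `u₂³ ∣ Y`
  have hg : ((u₂ : ℤ)) ^ 6 ∣ (Int.gcd (X ^ 3) (Y ^ 2) : ℤ) := by exact_mod_cast hu₂dvd
  have hdX : (u₂ : ℤ) ^ 2 ∣ X := by
    have h1 : ((u₂ : ℤ) ^ 2) ^ 3 ∣ X ^ 3 := by
      rw [← pow_mul]; exact hg.trans (Int.gcd_dvd_left _ _)
    exact (Int.pow_dvd_pow_iff (by norm_num)).mp h1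
  have hdY : (u₂ : ℤ) ^ 3 ∣ Y := by
    have h1 : ((u₂ : ℤ) ^ 3) ^ 2 ∣ Y ^ 2 := by
      rw [← pow_mul]; exact hg.trans (Int.gcd_dvd_right _ _)
    exact (Int.pow_dvd_pow_iff (by norm_num)).mp h1
  obtain ⟨x', hx'⟩ := hdX
  obtain ⟨y', hy'⟩ := hdY
  -- the rational identities `u²x = x'`, `u³y = y'`, `u = u₁/u₂`
  have hu : uRatio x y = (u₁ : ℚ) / (u₂ : ℚ) := by rw [uRatio, hu₁, hu₂]
  have hu₂0' : (u₂ : ℚ) ≠ 0 := by exact_mod_cast (show u₂ ≠ 0 by omega)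
  have hux : uRatio x y ^ 2 * x = x' := by
    have h1 : ((u₁ : ℕ) : ℚ) ^ 2 * x = ((u₂ : ℤ) ^ 2 * x' : ℤ) := by rw [hX, hx']
    push_cast at h1
    rw [hu, div_pow]
    field_simp
    linear_combination h1
  have huy : uRatio x y ^ 3 * y = y' := by
    have h1 : ((u₁ : ℕ) : ℚ) ^ 3 * y = ((u₂ : ℤ) ^ 3 * y' : ℤ) := by rw [hY, hy']
    push_cast at h1
    rw [hu, div_pow]
    field_simp
    linear_combination h1
  have hune : uRatio x y ≠ 0 := by rw [hu]; exact div_ne_zero hu₁0 hu₂0'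
  set a' : ℤ := y' ^ 2 - x' ^ 3 with ha'
  have hsol : y' ^ 2 = x' ^ 3 + a' := by rw [ha']; ring
  -- `a' = u⁶ a`
  have hua : uRatio x y ^ 6 * a = a' := by
    have : a = y ^ 2 - x ^ 3 := by rw [hxy]; ring
    rw [this, ha']; push_cast; rw [← hux, ← huy]; ring
  have ha'0 : a' ≠ 0 := by
    intro h
    have : uRatio x y ^ 6 * a = 0 := by rw [hua, h]; simp
    rcases mul_eq_zero.mp this with h1 | h1
    · exact pow_ne_zero 6 hune h1
    · exact ha h1
  -- primitivity of `(x', y')`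
  have hprim : IsPrimitivePair x' y' := by
    intro n h3 h2
    have hn0 : n ≠ 0 := by
      rintro rfl
      have hx0 : x' = 0 := by
        have : x' ^ 3 = 0 := by simpa using h3
        exact pow_eq_zero_iff (by norm_num) |>.mp this
      have hy0 : y' = 0 := by
        have : y' ^ 2 = 0 := by simpa using h2
        exact pow_eq_zero_iff (by norm_num) |>.mp this
      exact hXY ⟨by rw [hx', hx0]; ring, by rw [hy', hy0]; ring⟩
    -- `(n u₂)⁶ ∣ gcd(X³, Y²)`, so `|n| u₂ ≤ u₂`
    have h3' : ((n.natAbs * u₂ : ℕ) : ℤ) ^ 6 ∣ X ^ 3 := by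
      have e : X ^ 3 = ((u₂ : ℤ) ^ 2) ^ 3 * x' ^ 3 := by rw [hx']; ring
      rw [e]
      have : ((n.natAbs * u₂ : ℕ) : ℤ) ^ 6 = ((u₂ : ℤ) ^ 2) ^ 3 * (n.natAbs : ℤ) ^ 6 := by push_cast; ring
      rw [this, Int.natCast_natAbs, show |n| ^ 6 = n ^ 6 by rw [← abs_pow, abs_of_nonneg (by positivity)]]
      exact mul_dvd_mul_left _ h3
    have h2' : ((n.natAbs * u₂ : ℕ) : ℤ) ^ 6 ∣ Y ^ 2 := by
      have e : Y ^ 2 = ((u₂ : ℤ) ^ 3) ^ 2 * y' ^ 2 := by rw [hy']; ring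
      rw [e]
      have : ((n.natAbs * u₂ : ℕ) : ℤ) ^ 6 = ((u₂ : ℤ) ^ 3) ^ 2 * (n.natAbs : ℤ) ^ 6 := by push_cast; ring
      rw [this, Int.natCast_natAbs, show |n| ^ 6 = n ^ 6 by rw [← abs_pow, abs_of_nonneg (by positivity)]]
      exact mul_dvd_mul_left _ h2
    have hg' : (n.natAbs * u₂) ^ 6 ∣ Int.gcd (X ^ 3) (Y ^ 2) := by
      have := Int.dvd_coe_gcd h3' h2'
      exact_mod_cast this
    have hle := hu₂max _ hg'
    have hn1 : n.natAbs ≤ 1 := by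
      by_contra hlt
      have : 2 * u₂ ≤ n.natAbs * u₂ := Nat.mul_le_mul_right _ (by omega)
      omega
    have hn1' : n.natAbs = 1 := by
      have : n.natAbs ≠ 0 := Int.natAbs_ne_zero.mpr hn0
      omega
    rcases Int.natAbs_eq n with h | h <;> [left; right] <;> omega
  -- `a'_S ∣ a_S`
  have hlevel : mordellLevel S (a' : ℚ) ∣ mordellLevel S a := by
    rw [mordellLevel_def, mordellLevel_def, Rat.num_intCast]
    refine Nat.mul_dvd_mul_left _ ?_
    -- integer identity `a' · u₂⁶ · den(a) = u₁⁶ · num(a)`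
    have hid : a' * (u₂ : ℤ) ^ 6 * (a.den : ℤ) = (u₁ : ℤ) ^ 6 * a.num := by
      have h1 : (a' : ℚ) * (u₂ : ℚ) ^ 6 * (a.den : ℚ) = (u₁ : ℚ) ^ 6 * (a.num : ℚ) := by
        have hnd : (a.num : ℚ) = a * (a.den : ℚ) := by
          have := Rat.num_div_den a
          field_simp at this ⊢
          linear_combination this
        rw [hnd, ← hua, hu, div_pow]
        field_simp
      exact_mod_cast h1
    have hnum0 : a.num ≠ 0 := Rat.num_ne_zero.mpr ha
    -- for `p ∉ S`: `ord_p(a') ≤ ord_p(num a)`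
    have hval : ∀ p : ℕ, p.Prime → p ∉ S →
        padicValNat p a'.natAbs ≤ padicValNat p a.num.natAbs := by
      intro p hp hpS
      haveI : Fact p.Prime := ⟨hp⟩
      have hpu₁ : ¬ p ∣ u₁ := fun h =>
        hpS (primeFactors_uOne_subset hx hy (Nat.mem_primeFactors.mpr ⟨hp, h, (uOne_pos x y).ne'⟩))
      have hid' : a'.natAbs * (u₂ ^ 6 * a.den) = u₁ ^ 6 * a.num.natAbs := by
        have := congrArg Int.natAbs hid
        simp only [Int.natAbs_mul, Int.natAbs_pow, Int.natAbs_natCast] at this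
        rw [← this]; ring
      have hv := congrArg (padicValNat p) hid'
      have hu₂6 : u₂ ^ 6 * a.den ≠ 0 := mul_ne_zero (pow_ne_zero 6 (by omega)) a.den_nz
      have hu₁6 : u₁ ^ 6 ≠ 0 := pow_ne_zero 6 (uOne_pos x y).ne'
      rw [padicValNat.mul (Int.natAbs_ne_zero.mpr ha'0) hu₂6,
        padicValNat.mul hu₁6 (Int.natAbs_ne_zero.mpr hnum0), padicValNat.pow,
        padicValNat.eq_zero_of_not_dvd hpu₁] at hv
      omega
    have hsub : a'.natAbs.primeFactors \ S ⊆ a.num.natAbs.primeFactors \ S := by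
      intro p hp
      obtain ⟨hp1, hp2⟩ := Finset.mem_sdiff.mp hp
      have hpP := Nat.prime_of_mem_primeFactors hp1
      haveI : Fact p.Prime := ⟨hpP⟩
      refine Finset.mem_sdiff.mpr ⟨Nat.mem_primeFactors.mpr ⟨hpP, ?_, Int.natAbs_ne_zero.mpr hnum0⟩, hp2⟩
      have h1 : 1 ≤ padicValNat p a'.natAbs :=
        (padicValNat_dvd_iff_le (Int.natAbs_ne_zero.mpr ha'0)).mp
          (by simpa using Nat.dvd_of_mem_primeFactors hp1)
      have h2 := hval p hpP hp2
      have h3 := (padicValNat_dvd_iff_le (n := 1) (Int.natAbs_ne_zero.mpr hnum0)).mpr (h1.trans h2)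
      simpa using h3
    refine (Finset.prod_dvd_prod_of_dvd _ _ fun p hp => ?_).trans (Finset.prod_dvd_prod_of_subset _ _ _ hsub)
    obtain ⟨hp1, hp2⟩ := Finset.mem_sdiff.mp hp
    exact pow_dvd_pow p (min_le_min_left 2 (hval p (Nat.prime_of_mem_primeFactors hp1) hp2))
  -- heights
  have hha : logHeight₁ a ≤ 6 * logHeight₁ (uRatio x y) + Real.log |(a' : ℝ)| := by
    have e : a = (a' : ℚ) * (uRatio x y ^ 6)⁻¹ := by
      rw [← hua]; field_simp
    have h1 := logHeight₁_mul_le (a' : ℚ) ((uRatio x y ^ 6)⁻¹)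
    rw [← e, logHeight₁_inv, logHeight₁_pow] at h1
    have h2 : logHeight₁ (a' : ℚ) = Real.log |(a' : ℝ)| := by
      rw [Rat.logHeight₁_eq_log_max]
      have h1' : 1 ≤ a'.natAbs := Nat.one_le_iff_ne_zero.mpr (Int.natAbs_ne_zero.mpr ha'0)
      simp [max_eq_left h1', Nat.cast_natAbs, Int.cast_abs]
    push_cast at h1
    linarith
  have hhx : logHeight₁ x ≤ 2 * logHeight₁ (uRatio x y) + logHeight₁ (x' : ℚ) := by
    have e : x = (x' : ℚ) * (uRatio x y ^ 2)⁻¹ := by rw [← hux]; field_simp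
    have h1 := logHeight₁_mul_le (x' : ℚ) ((uRatio x y ^ 2)⁻¹)
    rw [← e, logHeight₁_inv, logHeight₁_pow] at h1
    push_cast at h1; linarith
  have hhy : logHeight₁ y ≤ 3 * logHeight₁ (uRatio x y) + logHeight₁ (y' : ℚ) := by
    have e : y = (y' : ℚ) * (uRatio x y ^ 3)⁻¹ := by rw [← huy]; field_simp
    have h1 := logHeight₁_mul_le (y' : ℚ) ((uRatio x y ^ 3)⁻¹)
    rw [← e, logHeight₁_inv, logHeight₁_pow] at h1
    push_cast at h1; linarith
  exact ⟨x', y', a', ha'0, hprim, hsol, hlevel, hha, hhx, hhy⟩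

end VonKanelMatschke

end Literature.NumberTheory.DiophantineGeometry

end
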